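import Literature.NumberTheory.ComplexMultiplication.FiniteQAlgebraLatticeSplitRankTwo
import HarnessLib

/-!
# Hertling–Larabi 2026b THEOREM 9.1 (c): the semigroup law of the `ε`-classes of `A = ℚe₁ ⊕ ℚe₂` —
# `L_{δ₁}·L_{δ₂} = ℤ(1/lcm(α₁,α₂), 0) + ℤ(δ₁δ₂, 1)`, `[L_{δ₁}]_ε·[L_{δ₂}]_ε = [L_{δ₃}]_ε` with `α₃ = gcd(α₁, α₂)`,
# `β₃ ≡ ±β₁β₂ (mod α₃)`, and `Λ_α·Λ_β = Λ_{gcd(α,β)}`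

[topic NumberTheory/ComplexMultiplication] General-`A` series (namespace
`Literature.NumberTheory.ComplexMultiplication.FiniteQAlgebraLattice`); sequel of `FiniteQAlgebraLatticeSplitRankTwo`
(HL26b Thm. 9.1 (a), (b), (d): the orders `Λ_α = ℤ(α,0) + ℤ(1,1)`, the normal forms `L_δ = ℤ(1,0) + ℤ(δ,1)`,
`mem_span_order_iff`, `span_normalForm_add_intCast`, `units_smul_span_normalForm_neg`) — REUSED by name; this file
supplies part (c), completing Theorem 9.1.  Lane `lit-hodgefound` (Track 2 foundations library), seat p19 generation
38, row g38-#10.  THEOREMS ONLY: no definition, no instance, no notation, no named fact (D-0026, net Literature debt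
`0`), no `sorry`.

DEF-FREE SPELLING.  `δ_i = β_i/α_i` in lowest terms is `β_i = Rat.num δ_i`, `α_i = Rat.den δ_i`; the product of
`ε`-classes `[L₁]_ε·[L₂]_ε = [L₃]_ε` is `∃ u : Aˣ, u • (L₁ * L₂) = L₃`; `β₃ ≡ εβ₁β₂ mod α₃` is `Int.ModEq`.

## Source, VERBATIM

C. Hertling, K. Larabi, *Conjugacy classes of regular integer matrices*, arXiv:2602.15748 (2026) [HertlingLarabi2026b],
held `paper:arxiv-2602.15748`, §9.2 Theorem 9.1 (chunk p0028): «(b) […] Here an order with invariant `α ∈ ℕ` in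
part (a) corresponds to `1/α` if `α ≥ 2` and to `0` if `α = 1` […]. (c) The semigroup structure in `𝓔(A)` corresponds
to the following semigroup structure on the set `[0, ½] ∩ ℚ`. Write `δ_i = β_i/α_i ∈ [0, ½] ∩ ℚ` with `β_i ∈ ℤ_{≥0}`,
`α_i ∈ ℕ`, `(β_i, α_i) = 1` for `i ∈ {1, 2, 3}`. Then `[L_{δ₁}]_ε·[L_{δ₂}]_ε = [L_{δ₃}]_ε` with `α₃ = gcd(α₁, α₂)`,
`β₃ ≡ εβ₁β₂ mod α₃` for some `ε ∈ {±1}`. Here the sign `ε` is chosen so that `εβ₁β₂ ≡ ([0, ½α₃] ∩ ℤ) mod α₃`. […]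
**Proof:** (c) The full lattice `L_{δ₁}·L_{δ₂}` is generated over `ℤ` by the following elements,
`e(1 β₁/α₁ β₂/α₂ β₁β₂/(α₁α₂); 0 0 0 1)`, so also by `e(1/α₁ 1/α₂ β₁β₂/(α₁α₂); 0 0 1)`, so also by
`e(1/lcm(α₁,α₂) β₁β₂/(α₁α₂); 0 1)`. The full lattices `((α₁,α₂)e₁ + e₂)L_{δ₁}L_{δ₂}` and
`((α₁,α₂)e₁ − e₂)L_{δ₁}L_{δ₂}` are generated by `e(1 β₁β₂/gcd(α₁,α₂); 0 1)` respectively by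
`e(1 −β₁β₂/gcd(α₁,α₂); 0 1)`. Both are `ε`-equivalent to `L_{δ₁}L_{δ₂}`.»  (The scaling unit is
`lcm(α₁,α₂)e₁ ± e₂`: `lcm(α₁,α₂)·β₁β₂/(α₁α₂) = β₁β₂/gcd(α₁,α₂)`.)

## What is proved (`A = ℚ × ℚ`; valid for ALL rationals `δ₁, δ₂`, in particular for the normal forms of Thm. 9.1 (b))

* §1 `mem_span_pair_axis_iff` (`(x,y) ∈ ℤ(q,0) + ℤ(p,1) ⟺ y ∈ ℤ ∧ x − yp ∈ ℤq`),
  **`span_normalForm_mul_span_normalForm`: `L_{δ₁}L_{δ₂} = ℤ(1/lcm(α₁,α₂), 0) + ℤ(δ₁δ₂, 1)`** (Bezout twice: `1/α_i ∈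
  ℤ + ℤδ_i`, `1/lcm = u/α₂ + v/α₁`).
* §2 `exists_units_smul_span_pair_axis_eq` (the unit `(q, 1)`), `exists_units_smul_mul_eq_span_normalForm`
  (`L_{δ₁}L_{δ₂} ∼_ε L_{β₁β₂/gcd(α₁,α₂)}`), and **`exists_units_smul_mul_eq_span_normalForm_mod` — THEOREM 9.1 (c): a
  unit `u` and `β₃ ∈ [0, ½α₃] ∩ ℤ`, `α₃ = gcd(α₁, α₂)`, `β₃ ≡ ±β₁β₂ (mod α₃)`, `gcd(β₃, α₃) = 1`, with
  `u·(L_{δ₁}L_{δ₂}) = L_{β₃/α₃}`** (reduction of `β₁β₂` modulo `α₃` and the sign flip of `FiniteQAlgebraLatticeSplitRankTwo`).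
* §3 `span_order_mul_span_order`: `Λ_α·Λ_β = Λ_{gcd(α,β)}` (the orders form the semigroup `(ℕ, gcd)`; (c) with (b)'s
  `δ = 1/α`).
NOT here: associativity/identification of `(𝓔(A), ·)` with an abstract semigroup on `[0, ½] ∩ ℚ` as a structure.

## References

* [HertlingLarabi2026b] C. Hertling, K. Larabi, *Conjugacy classes of regular integer matrices*, arXiv:2602.15748
  (2026), §9.2 Theorem 9.1 (b), (c) with proof (chunk p0028). [cite: HertlingLarabi2026b, §9.2 Thm. 9.1 (c)]
* [HertlingLarabi2026] C. Hertling, K. Larabi, *Semigroups from full lattices in commutative ℚ-algebras*,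
  arXiv:2602.14973 (2026), §5 (the semigroup `𝓔(A)` of `ε`-classes).
-/

noncomputable section

open scoped Pointwise
open Module Function Submodule

open Literature.NumberTheory.Automorphic (IsFullLattice mem_units_smul_submodule_iff)

namespace Literature.NumberTheory.ComplexMultiplication.FiniteQAlgebraLattice

section SplitRankTwoSemigroup

/-! ## §1 Lattices `⟨(q, 0), (p, 1)⟩_ℤ` and the product `L_{δ₁}·L_{δ₂}` -/

/-- Membership in `ℤ(q, 0) + ℤ(p, 1)`: `(x, y) ∈ ⟨(q,0), (p,1)⟩ ⟺ y ∈ ℤ ∧ x − yp ∈ ℤq`.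
[cite: HertlingLarabi2026b, §9.2 Theorem 9.1 (c) (proof), chunk p0028] -/
theorem mem_span_pair_axis_iff (q p x y : ℚ) :
    ((x, y) : ℚ × ℚ) ∈ span ℤ ({(q, (0 : ℚ)), (p, 1)} : Set (ℚ × ℚ)) ↔
      (∃ n : ℤ, (n : ℚ) = y) ∧ ∃ m : ℤ, (m : ℚ) * q = x - y * p := by
  rw [mem_span_pair]
  constructor
  · rintro ⟨a, b, hab⟩
    rw [Prod.ext_iff] at hab
    simp only [Prod.smul_mk, Prod.fst_add, Prod.snd_add, zsmul_eq_mul, mul_one, mul_zero, zero_add] at hab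
    obtain ⟨h1, h2⟩ := hab
    exact ⟨⟨b, h2⟩, a, by rw [← h1, ← h2]; ring⟩
  · rintro ⟨⟨n, hn⟩, m, hm⟩
    refine ⟨m, n, ?_⟩
    rw [Prod.ext_iff]
    simp only [Prod.smul_mk, Prod.fst_add, Prod.snd_add, zsmul_eq_mul, mul_one, mul_zero, zero_add]
    exact ⟨by rw [hn]; linear_combination hm, hn⟩

/-- `1/den(δ) ∈ ℤ + ℤδ` (Bezout for `num(δ)`, `den(δ)`), as a point of the `x`-axis of a product lattice containing
`(1, 0)` and `(δ, 0)`. [folklore] -/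
private theorem inv_den_mem {L : Submodule ℤ (ℚ × ℚ)} (δ : ℚ) (h1 : (((1 : ℚ), (0 : ℚ)) : ℚ × ℚ) ∈ L)
    (hδ : ((δ, (0 : ℚ)) : ℚ × ℚ) ∈ L) : ((((δ.den : ℚ))⁻¹, (0 : ℚ)) : ℚ × ℚ) ∈ L := by
  have hcop : IsCoprime δ.num (δ.den : ℤ) := by
    rw [Int.isCoprime_iff_gcd_eq_one, Int.gcd_eq_natAbs, Int.natAbs_natCast]
    exact δ.reduced
  obtain ⟨a, b, hab⟩ := hcop
  have hden : (δ.den : ℚ) ≠ 0 := by exact_mod_cast δ.den_nz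
  have e : ((((δ.den : ℚ))⁻¹, (0 : ℚ)) : ℚ × ℚ) = a • ((δ, (0 : ℚ)) : ℚ × ℚ) + b • (((1 : ℚ), (0 : ℚ)) : ℚ × ℚ) := by
    rw [Prod.ext_iff]
    simp only [Prod.smul_mk, Prod.fst_add, Prod.snd_add, zsmul_eq_mul, mul_one, mul_zero, add_zero]
    refine ⟨?_, trivial⟩
    rw [eq_comm, ← one_div, eq_div_iff hden, add_mul, mul_assoc, Rat.mul_den_eq_num]
    exact_mod_cast hab
  rw [e]
  exact add_mem (smul_mem _ _ hδ) (smul_mem _ _ h1)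

/-- **THEOREM 9.1 (c), the product lattice** «The full lattice `L_{δ₁}·L_{δ₂}` is generated over `ℤ` by
`e(1 β₁/α₁ β₂/α₂ β₁β₂/(α₁α₂); 0 0 0 1)`, so also by […] `e(1/lcm(α₁,α₂) β₁β₂/(α₁α₂); 0 1)`»:
`L_{δ₁}L_{δ₂} = ℤ(1/lcm(den δ₁, den δ₂), 0) + ℤ(δ₁δ₂, 1)`. [cite: HertlingLarabi2026b, §9.2 Theorem 9.1 (c) (proof),
chunk p0028] -/
theorem span_normalForm_mul_span_normalForm (δ₁ δ₂ : ℚ) :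
    span ℤ ({((1 : ℚ), (0 : ℚ)), (δ₁, 1)} : Set (ℚ × ℚ)) * span ℤ ({((1 : ℚ), (0 : ℚ)), (δ₂, 1)} : Set (ℚ × ℚ)) =
      span ℤ ({(((Nat.lcm δ₁.den δ₂.den : ℚ))⁻¹, (0 : ℚ)), (δ₁ * δ₂, 1)} : Set (ℚ × ℚ)) := by
  set ℓ : ℕ := Nat.lcm δ₁.den δ₂.den with hℓ
  have hℓ0 : (ℓ : ℚ) ≠ 0 := by exact_mod_cast (Nat.lcm_pos δ₁.den_pos δ₂.den_pos).ne'
  have hℓinv : ((ℓ : ℚ))⁻¹ ≠ 0 := inv_ne_zero hℓ0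
  rw [span_mul_span]
  refine le_antisymm ?_ ?_
  · -- the four products lie in the right-hand side
    rw [span_le]
    rintro _ ⟨x, hx, y, hy, rfl⟩
    simp only [Set.mem_insert_iff, Set.mem_singleton_iff] at hx hy
    dsimp only
    rcases hx with rfl | rfl <;> rcases hy with rfl | rfl
    · rw [Prod.mk_mul_mk, one_mul, mul_zero, SetLike.mem_coe, mem_span_pair_axis_iff]
      exact ⟨⟨0, by simp⟩, ℓ, by rw [Int.cast_natCast, mul_inv_cancel₀ hℓ0]; simp⟩
    · rw [Prod.mk_mul_mk, one_mul, zero_mul, SetLike.mem_coe, mem_span_pair_axis_iff]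
      obtain ⟨k, hk⟩ := Nat.dvd_lcm_right δ₁.den δ₂.den
      refine ⟨⟨0, by simp⟩, k * δ₂.num, ?_⟩
      have h : (ℓ : ℚ) = δ₂.den * k := by rw [hℓ, hk]; push_cast; ring
      rw [zero_mul, sub_zero, mul_inv_eq_iff_eq_mul₀ hℓ0, h]
      push_cast
      rw [← Rat.mul_den_eq_num δ₂]
      ring
    · rw [Prod.mk_mul_mk, mul_one, one_mul, SetLike.mem_coe, mem_span_pair_axis_iff]
      obtain ⟨k, hk⟩ := Nat.dvd_lcm_left δ₁.den δ₂.den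
      refine ⟨⟨0, by simp⟩, k * δ₁.num, ?_⟩
      have h : (ℓ : ℚ) = δ₁.den * k := by rw [hℓ, hk]; push_cast; ring
      rw [zero_mul, sub_zero, mul_inv_eq_iff_eq_mul₀ hℓ0, h]
      push_cast
      rw [← Rat.mul_den_eq_num δ₁]
      ring
    · rw [Prod.mk_mul_mk, mul_one]
      exact subset_span (Set.mem_insert_of_mem _ rfl)
  · -- `(1/ℓ, 0)` and `(δ₁δ₂, 1)` lie in the product
    set M : Submodule ℤ (ℚ × ℚ) := span ℤ (({((1 : ℚ), (0 : ℚ)), (δ₁, 1)} : Set (ℚ × ℚ)) *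
      ({((1 : ℚ), (0 : ℚ)), (δ₂, 1)} : Set (ℚ × ℚ))) with hM
    have hmem : ∀ v ∈ ({((1 : ℚ), (0 : ℚ)), (δ₁, 1)} : Set (ℚ × ℚ)), ∀ w ∈ ({((1 : ℚ), (0 : ℚ)), (δ₂, 1)} : Set (ℚ × ℚ)),
        v * w ∈ M := fun v hv w hw => subset_span (Set.mul_mem_mul hv hw)
    have h11 : (((1 : ℚ), (0 : ℚ)) : ℚ × ℚ) ∈ M := by
      simpa using hmem _ (Set.mem_insert _ _) _ (Set.mem_insert _ _)
    have hδ₁ : ((δ₁, (0 : ℚ)) : ℚ × ℚ) ∈ M := by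
      simpa using hmem _ (Set.mem_insert_of_mem _ rfl) _ (Set.mem_insert _ _)
    have hδ₂ : ((δ₂, (0 : ℚ)) : ℚ × ℚ) ∈ M := by
      simpa using hmem _ (Set.mem_insert _ _) _ (Set.mem_insert_of_mem _ rfl)
    have hδ₁₂ : ((δ₁ * δ₂, (1 : ℚ)) : ℚ × ℚ) ∈ M := by
      simpa using hmem _ (Set.mem_insert_of_mem _ rfl) _ (Set.mem_insert_of_mem _ rfl)
    have hd₁ := inv_den_mem δ₁ h11 hδ₁
    have hd₂ := inv_den_mem δ₂ h11 hδ₂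
    -- `1/ℓ = gcd/(d₁d₂) = u/d₂ + v/d₁` with `gcd = u d₁ + v d₂`
    have hbez := Nat.gcd_eq_gcd_ab δ₁.den δ₂.den
    have hgl : ((Nat.gcd δ₁.den δ₂.den : ℕ) : ℚ) * ℓ = δ₁.den * δ₂.den := by
      rw [hℓ]; exact_mod_cast Nat.gcd_mul_lcm δ₁.den δ₂.den
    have hd₁0 : (δ₁.den : ℚ) ≠ 0 := by exact_mod_cast δ₁.den_nz
    have hd₂0 : (δ₂.den : ℚ) ≠ 0 := by exact_mod_cast δ₂.den_nz
    have e : ((((ℓ : ℚ))⁻¹, (0 : ℚ)) : ℚ × ℚ) =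
        Nat.gcdA δ₁.den δ₂.den • ((((δ₂.den : ℚ))⁻¹, (0 : ℚ)) : ℚ × ℚ) +
          Nat.gcdB δ₁.den δ₂.den • ((((δ₁.den : ℚ))⁻¹, (0 : ℚ)) : ℚ × ℚ) := by
      rw [Prod.ext_iff]
      simp only [Prod.smul_mk, Prod.fst_add, Prod.snd_add, zsmul_eq_mul, mul_zero, add_zero]
      refine ⟨?_, trivial⟩
      have hbez' : ((Nat.gcd δ₁.den δ₂.den : ℕ) : ℚ) = δ₁.den * Nat.gcdA δ₁.den δ₂.den + δ₂.den * Nat.gcdB δ₁.den δ₂.den := by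
        exact_mod_cast hbez
      rw [hbez'] at hgl
      field_simp
      linear_combination -hgl
    rw [span_le]
    rintro v hv
    simp only [Set.mem_insert_iff, Set.mem_singleton_iff] at hv
    rcases hv with rfl | rfl
    · rw [SetLike.mem_coe, e]
      exact add_mem (smul_mem _ _ hd₂) (smul_mem _ _ hd₁)
    · exact hδ₁₂

/-! ## §2 THEOREM 9.1 (c): `[L_{δ₁}]_ε · [L_{δ₂}]_ε = [L_{δ₃}]_ε`, `α₃ = gcd(α₁, α₂)`, `β₃ ≡ ±β₁β₂ (mod α₃)` -/

/-- Scaling the `x`-axis: the unit `(q, 1)` maps `⟨(1/q, 0), (p, 1)⟩` onto `L_{qp} = ⟨(1, 0), (qp, 1)⟩`.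
[cite: HertlingLarabi2026b, §9.2 Theorem 9.1 (c) (proof), chunk p0028] -/
theorem exists_units_smul_span_pair_axis_eq {q : ℚ} (hq : q ≠ 0) (p : ℚ) :
    ∃ u : (ℚ × ℚ)ˣ, u • span ℤ ({(q⁻¹, (0 : ℚ)), (p, 1)} : Set (ℚ × ℚ)) =
      span ℤ ({((1 : ℚ), (0 : ℚ)), (q * p, 1)} : Set (ℚ × ℚ)) := by
  refine ⟨Units.mkOfMulEqOne ((q, (1 : ℚ)) : ℚ × ℚ) (q⁻¹, 1)
    (by rw [Prod.mk_mul_mk, mul_inv_cancel₀ hq, mul_one]; rfl), ?_⟩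
  rw [Units.smul_def, Submodule.smul_span, Set.smul_set_insert, Set.smul_set_singleton, smul_eq_mul, smul_eq_mul]
  change span ℤ ({((q, (1 : ℚ)) : ℚ × ℚ) * (q⁻¹, 0), ((q, (1 : ℚ)) : ℚ × ℚ) * (p, 1)} : Set (ℚ × ℚ)) = _
  rw [Prod.mk_mul_mk, Prod.mk_mul_mk, mul_inv_cancel₀ hq, mul_zero, one_mul]

/-- **THEOREM 9.1 (c), product of classes, raw form**: `L_{δ₁}L_{δ₂} ∼_ε L_{δ'}` with
`δ' = lcm(den δ₁, den δ₂)·δ₁δ₂ = num δ₁·num δ₂ / gcd(den δ₁, den δ₂)`.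
[cite: HertlingLarabi2026b, §9.2 Theorem 9.1 (c), chunk p0028] -/
theorem exists_units_smul_mul_eq_span_normalForm (δ₁ δ₂ : ℚ) :
    ∃ u : (ℚ × ℚ)ˣ, u • (span ℤ ({((1 : ℚ), (0 : ℚ)), (δ₁, 1)} : Set (ℚ × ℚ)) *
        span ℤ ({((1 : ℚ), (0 : ℚ)), (δ₂, 1)} : Set (ℚ × ℚ))) =
      span ℤ ({((1 : ℚ), (0 : ℚ)), ((((δ₁.num * δ₂.num : ℤ)) : ℚ) / ((Nat.gcd δ₁.den δ₂.den : ℕ) : ℚ), 1)} :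
        Set (ℚ × ℚ)) := by
  have hℓ0 : ((Nat.lcm δ₁.den δ₂.den : ℕ) : ℚ) ≠ 0 := by
    exact_mod_cast (Nat.lcm_pos δ₁.den_pos δ₂.den_pos).ne'
  obtain ⟨u, hu⟩ := exists_units_smul_span_pair_axis_eq hℓ0 (δ₁ * δ₂)
  refine ⟨u, ?_⟩
  -- `ℓ δ₁ δ₂ = n₁ n₂ / g`
  have hgl : ((Nat.gcd δ₁.den δ₂.den : ℕ) : ℚ) * (Nat.lcm δ₁.den δ₂.den : ℕ) = δ₁.den * δ₂.den := by
    exact_mod_cast Nat.gcd_mul_lcm δ₁.den δ₂.den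
  have hg0 : ((Nat.gcd δ₁.den δ₂.den : ℕ) : ℚ) ≠ 0 := by
    exact_mod_cast (Nat.gcd_pos_of_pos_left _ δ₁.den_pos).ne'
  have hkey : ((Nat.lcm δ₁.den δ₂.den : ℕ) : ℚ) * (δ₁ * δ₂) =
      ((δ₁.num * δ₂.num : ℤ) : ℚ) / ((Nat.gcd δ₁.den δ₂.den : ℕ) : ℚ) := by
    rw [eq_div_iff hg0]
    calc ((Nat.lcm δ₁.den δ₂.den : ℕ) : ℚ) * (δ₁ * δ₂) * ((Nat.gcd δ₁.den δ₂.den : ℕ) : ℚ)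
        = (((Nat.gcd δ₁.den δ₂.den : ℕ) : ℚ) * (Nat.lcm δ₁.den δ₂.den : ℕ)) * (δ₁ * δ₂) := by ring
      _ = (δ₁ * δ₁.den) * (δ₂ * δ₂.den) := by rw [hgl]; ring
      _ = ((δ₁.num * δ₂.num : ℤ) : ℚ) := by rw [Rat.mul_den_eq_num, Rat.mul_den_eq_num]; push_cast; ring
  rw [span_normalForm_mul_span_normalForm, hu, hkey]

/-- `gcd(num δ₁ · num δ₂, gcd(den δ₁, den δ₂)) = 1`. [folklore] -/
private theorem isCoprime_num_mul_num_gcd (δ₁ δ₂ : ℚ) :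
    IsCoprime (δ₁.num * δ₂.num) ((Nat.gcd δ₁.den δ₂.den : ℕ) : ℤ) := by
  have h : ∀ δ : ℚ, ∀ {g : ℕ}, g ∣ δ.den → IsCoprime δ.num (g : ℤ) := fun δ g hg => by
    rw [Int.isCoprime_iff_gcd_eq_one, Int.gcd_eq_natAbs, Int.natAbs_natCast]
    exact Nat.Coprime.coprime_dvd_right hg δ.reduced
  exact (h δ₁ (Nat.gcd_dvd_left _ _)).mul_left (h δ₂ (Nat.gcd_dvd_right _ _))

/-- **THEOREM 9.1 (c)** «Write `δ_i = β_i/α_i ∈ [0, ½] ∩ ℚ` with `β_i ∈ ℤ_{≥0}`, `α_i ∈ ℕ`, `(β_i, α_i) = 1`. Then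
`[L_{δ₁}]_ε·[L_{δ₂}]_ε = [L_{δ₃}]_ε` with `α₃ = gcd(α₁, α₂)`, `β₃ ≡ εβ₁β₂ mod α₃` for some `ε ∈ {±1}`. Here the sign
`ε` is chosen so that `εβ₁β₂ ≡ ([0, ½α₃] ∩ ℤ) mod α₃`»: for all rationals `δ₁, δ₂` (`β_i = num δ_i`, `α_i = den δ_i`)
there are a unit `u` and an integer `β₃` with `0 ≤ β₃ ≤ ½α₃`, `α₃ = gcd(α₁, α₂)`, `β₃ ≡ ±β₁β₂ (mod α₃)` and
`u·(L_{δ₁}L_{δ₂}) = L_{β₃/α₃}`; moreover `gcd(β₃, α₃) = 1`, so `β₃/α₃` is the normal form `δ₃` of Thm. 9.1 (b).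
[cite: HertlingLarabi2026b, §9.2 Theorem 9.1 (c), chunk p0028] -/
theorem exists_units_smul_mul_eq_span_normalForm_mod (δ₁ δ₂ : ℚ) :
    ∃ u : (ℚ × ℚ)ˣ, ∃ β₃ : ℤ, 0 ≤ β₃ ∧ 2 * β₃ ≤ (Nat.gcd δ₁.den δ₂.den : ℕ) ∧
      (β₃ ≡ δ₁.num * δ₂.num [ZMOD (Nat.gcd δ₁.den δ₂.den : ℕ)] ∨
        β₃ ≡ -(δ₁.num * δ₂.num) [ZMOD (Nat.gcd δ₁.den δ₂.den : ℕ)]) ∧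
      IsCoprime β₃ ((Nat.gcd δ₁.den δ₂.den : ℕ) : ℤ) ∧
      u • (span ℤ ({((1 : ℚ), (0 : ℚ)), (δ₁, 1)} : Set (ℚ × ℚ)) *
          span ℤ ({((1 : ℚ), (0 : ℚ)), (δ₂, 1)} : Set (ℚ × ℚ))) =
        span ℤ ({((1 : ℚ), (0 : ℚ)), ((β₃ : ℚ) / (Nat.gcd δ₁.den δ₂.den : ℕ), 1)} : Set (ℚ × ℚ)) := by
  set g : ℕ := Nat.gcd δ₁.den δ₂.den with hg
  set β : ℤ := δ₁.num * δ₂.num with hβ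
  have hg0 : 0 < g := Nat.gcd_pos_of_pos_left _ δ₁.den_pos
  have hgz : (g : ℤ) ≠ 0 := by exact_mod_cast hg0.ne'
  have hgq : (g : ℚ) ≠ 0 := by exact_mod_cast hg0.ne'
  have hcop : IsCoprime β (g : ℤ) := isCoprime_num_mul_num_gcd δ₁ δ₂
  obtain ⟨u₀, hu₀⟩ := exists_units_smul_mul_eq_span_normalForm δ₁ δ₂
  -- reduce `β` modulo `g`: `β/g = (β / g : ℤ) + r/g`, `r = β mod g ∈ [0, g)`
  set r : ℤ := β % g with hr
  have hr0 : 0 ≤ r := Int.emod_nonneg β hgz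
  have hr1 : r < g := by
    have := Int.emod_lt β hgz
    rwa [Int.natAbs_natCast] at this
  have hβr : (β : ℚ) / g = (r : ℚ) / g + ((β / g : ℤ) : ℤ) := by
    rw [hr, Int.emod_def]
    push_cast
    field_simp
    ring
  have h1 : u₀ • (span ℤ ({((1 : ℚ), (0 : ℚ)), (δ₁, 1)} : Set (ℚ × ℚ)) *
      span ℤ ({((1 : ℚ), (0 : ℚ)), (δ₂, 1)} : Set (ℚ × ℚ))) =
      span ℤ ({((1 : ℚ), (0 : ℚ)), ((r : ℚ) / g, 1)} : Set (ℚ × ℚ)) := by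
    rw [hu₀, ← span_normalForm_add_intCast ((r : ℚ) / g) (β / g), ← hβr]
  have hrmod : r ≡ β [ZMOD g] := Int.mod_modEq β g
  have hcopr : ∀ {s : ℤ}, (s ≡ β [ZMOD g] ∨ s ≡ -β [ZMOD g]) → IsCoprime s (g : ℤ) := by
    rintro s (hs | hs)
    · obtain ⟨k, hk⟩ := (Int.modEq_iff_dvd.1 hs.symm)
      have e : s = β + (g : ℤ) * k := by linear_combination hk
      rw [e]
      exact hcop.add_mul_left_left k
    · obtain ⟨k, hk⟩ := (Int.modEq_iff_dvd.1 hs.symm)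
      have e : s = -β + (g : ℤ) * k := by linear_combination hk
      rw [e]
      exact hcop.neg_left.add_mul_left_left k
  by_cases hle : 2 * r ≤ g
  · exact ⟨u₀, r, hr0, hle, Or.inl hrmod, hcopr (Or.inl hrmod), h1⟩
  · -- flip the sign: `(−1, 1)·L_{r/g} = L_{−r/g} = L_{(g − r)/g}`
    set w : (ℚ × ℚ)ˣ := Units.mkOfMulEqOne (((-1 : ℚ), (1 : ℚ)) : ℚ × ℚ) ((-1 : ℚ), (1 : ℚ))
      (by rw [Prod.mk_mul_mk]; norm_num) with hw_def
    have hw : (w : ℚ × ℚ) = (-1, 1) := rfl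
    have hmod' : (g : ℤ) - r ≡ -β [ZMOD g] := by
      have h2 : (g : ℤ) - r ≡ 0 - r [ZMOD g] :=
        Int.ModEq.sub_right r (Int.modEq_zero_iff_dvd.2 (dvd_refl _))
      rw [zero_sub] at h2
      exact h2.trans hrmod.neg
    refine ⟨w * u₀, g - r, by omega, by omega, Or.inr hmod', hcopr (Or.inr hmod'), ?_⟩
    rw [mul_smul, h1, units_smul_span_normalForm_neg _ hw,
      show -((r : ℚ) / g) = (((g : ℤ) - r : ℤ) : ℚ) / g + ((-1 : ℤ) : ℤ) by push_cast; field_simp; ring,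
      span_normalForm_add_intCast]

/-! ## §3 The orders multiply by `gcd`: `Λ_α·Λ_β = Λ_{gcd(α, β)}` -/

/-- **THEOREM 9.1 (c) on the orders** (with (b): «an order with invariant `α ∈ ℕ` in part (a) corresponds to `1/α`»,
so `δ_i = 1/α_i`, `β_i = 1`, and (c) gives `α₃ = gcd(α₁, α₂)`, `β₃ = 1`): `Λ_α·Λ_β = Λ_{gcd(α,β)}` for `α, β ≥ 1` —
the semigroup of orders of `ℚe₁ ⊕ ℚe₂` is `(ℕ, gcd)`. [cite: HertlingLarabi2026b, §9.2 Theorem 9.1 (b), (c), chunk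
p0028] -/
theorem span_order_mul_span_order (α β : ℕ) :
    span ℤ ({((α : ℚ), (0 : ℚ)), (1, 1)} : Set (ℚ × ℚ)) * span ℤ ({((β : ℚ), (0 : ℚ)), (1, 1)} : Set (ℚ × ℚ)) =
      span ℤ ({(((Nat.gcd α β : ℕ) : ℚ), (0 : ℚ)), (1, 1)} : Set (ℚ × ℚ)) := by
  rw [span_mul_span]
  refine le_antisymm ?_ ?_
  · rw [span_le]
    rintro _ ⟨x, hx, y, hy, rfl⟩
    simp only [Set.mem_insert_iff, Set.mem_singleton_iff] at hx hy
    dsimp only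
    rcases hx with rfl | rfl <;> rcases hy with rfl | rfl
    · rw [Prod.mk_mul_mk, mul_zero, SetLike.mem_coe, mem_span_order_iff]
      obtain ⟨k, hk⟩ := Nat.gcd_dvd_left α β
      refine ⟨⟨0, by simp⟩, k * β, ?_⟩
      rw [sub_zero]
      nth_rewrite 2 [hk]
      push_cast
      ring
    · rw [Prod.mk_mul_mk, mul_one, mul_one, SetLike.mem_coe, mem_span_order_iff]
      obtain ⟨k, hk⟩ := Nat.gcd_dvd_left α β
      refine ⟨⟨0, by simp⟩, k, ?_⟩
      rw [sub_zero]
      nth_rewrite 2 [hk]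
      push_cast
      ring
    · rw [Prod.mk_mul_mk, one_mul, one_mul, SetLike.mem_coe, mem_span_order_iff]
      obtain ⟨k, hk⟩ := Nat.gcd_dvd_right α β
      refine ⟨⟨0, by simp⟩, k, ?_⟩
      rw [sub_zero]
      nth_rewrite 2 [hk]
      push_cast
      ring
    · rw [Prod.mk_mul_mk, one_mul]
      exact subset_span (Set.mem_insert_of_mem _ rfl)
  · set M : Submodule ℤ (ℚ × ℚ) := span ℤ (({((α : ℚ), (0 : ℚ)), (1, 1)} : Set (ℚ × ℚ)) *
      ({((β : ℚ), (0 : ℚ)), (1, 1)} : Set (ℚ × ℚ))) with hM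
    have hmem : ∀ v ∈ ({((α : ℚ), (0 : ℚ)), (1, 1)} : Set (ℚ × ℚ)), ∀ w ∈ ({((β : ℚ), (0 : ℚ)), (1, 1)} : Set (ℚ × ℚ)),
        v * w ∈ M := fun v hv w hw => subset_span (Set.mul_mem_mul hv hw)
    have hα : (((α : ℚ), (0 : ℚ)) : ℚ × ℚ) ∈ M := by
      simpa using hmem _ (Set.mem_insert _ _) _ (Set.mem_insert_of_mem _ rfl)
    have hβ : (((β : ℚ), (0 : ℚ)) : ℚ × ℚ) ∈ M := by
      simpa using hmem _ (Set.mem_insert_of_mem _ rfl) _ (Set.mem_insert _ _)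
    have h1 : (((1 : ℚ), (1 : ℚ)) : ℚ × ℚ) ∈ M := by
      simpa using hmem _ (Set.mem_insert_of_mem _ rfl) _ (Set.mem_insert_of_mem _ rfl)
    have e : ((((Nat.gcd α β : ℕ) : ℚ), (0 : ℚ)) : ℚ × ℚ) =
        Nat.gcdA α β • (((α : ℚ), (0 : ℚ)) : ℚ × ℚ) + Nat.gcdB α β • (((β : ℚ), (0 : ℚ)) : ℚ × ℚ) := by
      rw [Prod.ext_iff]
      simp only [Prod.smul_mk, Prod.fst_add, Prod.snd_add, zsmul_eq_mul, mul_zero, add_zero]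
      refine ⟨?_, trivial⟩
      have h := Nat.gcd_eq_gcd_ab α β
      have h' : ((Nat.gcd α β : ℕ) : ℚ) = α * Nat.gcdA α β + β * Nat.gcdB α β := by exact_mod_cast h
      rw [h']
      ring
    rw [span_le]
    rintro v hv
    simp only [Set.mem_insert_iff, Set.mem_singleton_iff] at hv
    rcases hv with rfl | rfl
    · rw [SetLike.mem_coe, e]
      exact add_mem (smul_mem _ _ hα) (smul_mem _ _ hβ)
    · exact h1

end SplitRankTwoSemigroup

end Literature.NumberTheory.ComplexMultiplication.FiniteQAlgebraLattice
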